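import Literature.NumberTheory.Automorphic.TorusCharacterSplitRigidityLocal
import Literature.NumberTheory.Rogawski1990.GlobalAPacketMembership
import HarnessLib

/-!
# A one-dimensional automorphic `ξ = (η, ψ)` of `H = U(2) × U(1)` is determined by its split-place labels
# (family rigidity U♭, global half; Rogawski 1990 §13.1, §12.2; weak approximation for `U(1)`)

Topic `NumberTheory/Rogawski1990`; namespace `Literature.NumberTheory.Rogawski1990.OneDimAutRepH`.  PROOF FILE (theorems only; no
definition, no named fact, no instance, no notation, no `sorry`).  CM frame of ★ `OneDimAutRepH` ∕ ★ `GlobalAPacketMembership`: `L` a CM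
field, `L⁺ = maximalRealSubfield L`, `c̄ = IsCMField.complexConj L`, `ξ = (η, ψ) : OneDimAutRepH L` a pair of automorphic characters
of the norm-one torus `T(𝔸_{L⁺}) = TorusDict.torus c̄`, with base changes `η̃ = ξ.bcη`, `ψ̃ = ξ.bcψ` (Hecke characters of `L`) and the
SPLIT-PLACE LABELS of the ξ-local family D6 (★ `OneDimAutRepH.IsXiLocalFamily`): at a place `w` of `L` above a split `v`,
`ξ.locη w = η̃_w⁻¹`, `ξ.locψ w = ψ̃_w⁻¹` and `ξ.splitν₀ μω w = η_w ψ_w μ_w` (the `GL₂`-block of the split member `i_G(ξ_v ⊗ μ_w ∘ det₀)`).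

THE THEOREMS — all from ★ `UnitaryGroup.torusCharacter_eq_of_split` (`TorusCharacterSplitRigidity`: an automorphic character of
`U(1)_{L/L⁺}` is determined by the local components of its base change at the `c̄`-MOVED places — weak approximation for the rational
torus, no `L`-functions) applied to `η` and to `ψ` (★ `OneDimAutRepH.ext`):
* `ext_of_bc_localComponent_eq_of_split` — `η̃_w = η̃′_w` and `ψ̃_w = ψ̃′_w` at every `c̄`-moved finite `w` ⇒ `ξ = ξ′`;
* `ext_of_exists_bc_localComponent_eq_of_split` ∕ `ext_of_locLabels_eq_of_split` — for every split `v`, at ONE place `w ∣ v` the base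
  changes (resp. the labels) agree, e.g. `ξ.locη w = ξ′.locη w` and
  `ξ.locψ w = ξ′.locψ w` ⇒ `ξ = ξ′` (the other place `c̄ • w` is carried by ★ `pullback_localComponent_smul`, through ★
  `UnitaryGroup.torusCharacter_eq_of_split'`; the fibre above a split `v` is `{w, c̄⁻¹ • w}`, ★ `PlacesOver.eq_or_eq_galInv`);
* `ext_of_splitLabels_eq_of_split` — the same with the D6 labels `(splitν₀ μω, locψ)` of ★ `cmSplitPacket` for ONE auxiliary Hecke
  character `μω` (the `μ_w`-factor cancels): two ξ, ξ′ whose ξ-local families have THE SAME SPLIT MEMBER at one place above every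
  split `v` are equal.  This is the global input of «a ξ-local family determines ξ» (rung-4 memo, U♭); the local input — that the
  split member `i_G(ξ_v ⊗ μ_w ∘ det₀)` determines its labels — is representation theory of `GL₃(L_w)` and is NOT claimed here.

## References
* J. Rogawski, *Automorphic Representations of Unitary Groups in Three Variables* (1990), §13.1 p. 199 (`Π(ξ)` indexed by `ξ`), §12.2
  pp. 173–174 (`ξ_v`, the split member), §4.13 Lemma 4.13.1 (b) [Rogawski1990].
* J. W. S. Cassels, A. Fröhlich (eds.), *Algebraic Number Theory* (1967), Ch. II §6, Ch. VII §4 Prop. 4.1 [CasselsFrohlichANT1967].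
* V. Platonov, A. Rapinchuk, *Algebraic Groups and Number Theory* (1994), §7.3 Prop. 7.8 [PlatonovRapinchuk1994].
-/

set_option autoImplicit false

noncomputable section

open NumberField IsDedekindDomain
open Literature.NumberTheory.GaloisRepresentations
open Literature.NumberTheory.Automorphic Literature.NumberTheory.Automorphic.UnitaryGroup
open Literature.NumberTheory.Automorphic.Arthur2013.Leaves.TECR

namespace Literature.NumberTheory.Rogawski1990

namespace OneDimAutRepH

variable {L : Type} [Field L] [NumberField L] [IsCMField L]

/-- **`ξ = ξ′` from the base changes at the moved places**: if `η̃_w = η̃′_w` and `ψ̃_w = ψ̃′_w` (★ `HeckeCharacter.localComponent` of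
★ `bcη`, ★ `bcψ`) at every finite place `w` of `L` with `c̄ • w ≠ w`, then `ξ = ξ′`. [cite: Rogawski1990, §13.1 p. 199]
[cite: CasselsFrohlichANT1967, Ch. VII §4 Prop. 4.1] [cite: PlatonovRapinchuk1994, §7.3 Prop. 7.8] -/
theorem ext_of_bc_localComponent_eq_of_split {ξ ξ' : OneDimAutRepH L}
    (hη : ∀ w : HeightOneSpectrum (𝓞 L), IsCMField.complexConj L • w ≠ w → ξ.bcη.localComponent w = ξ'.bcη.localComponent w)
    (hψ : ∀ w : HeightOneSpectrum (𝓞 L), IsCMField.complexConj L • w ≠ w → ξ.bcψ.localComponent w = ξ'.bcψ.localComponent w) :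
    ξ = ξ' :=
  OneDimAutRepH.ext
    (torusCharacter_eq_of_split (IsCMField.complexConj L) (Algebra.IsQuadraticExtension.finrank_eq_two _ L)
      (IsCMField.complexConj_ne_one (K := L)) ξ.η ξ'.η ξ.hη ξ'.hη hη)
    (torusCharacter_eq_of_split (IsCMField.complexConj L) (Algebra.IsQuadraticExtension.finrank_eq_two _ L)
      (IsCMField.complexConj_ne_one (K := L)) ξ.ψ ξ'.ψ ξ.hψ ξ'.hψ hψ)

/-- **`ξ = ξ′` from the base changes at ONE place of each pair `{w, c̄ • w}`** (★ `UnitaryGroup.torusCharacter_eq_of_split'`).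
[cite: Rogawski1990, §12.2 pp. 173–174] [cite: CasselsFrohlichANT1967, Ch. VII §4 Prop. 4.1] -/
theorem ext_of_bc_localComponent_eq_of_split' {ξ ξ' : OneDimAutRepH L}
    (hη : ∀ w : HeightOneSpectrum (𝓞 L), IsCMField.complexConj L • w ≠ w →
      ξ.bcη.localComponent w = ξ'.bcη.localComponent w ∨
        ξ.bcη.localComponent (IsCMField.complexConj L • w) = ξ'.bcη.localComponent (IsCMField.complexConj L • w))
    (hψ : ∀ w : HeightOneSpectrum (𝓞 L), IsCMField.complexConj L • w ≠ w →
      ξ.bcψ.localComponent w = ξ'.bcψ.localComponent w ∨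
        ξ.bcψ.localComponent (IsCMField.complexConj L • w) = ξ'.bcψ.localComponent (IsCMField.complexConj L • w)) :
    ξ = ξ' :=
  OneDimAutRepH.ext
    (torusCharacter_eq_of_split' (IsCMField.complexConj L) (Algebra.IsQuadraticExtension.finrank_eq_two _ L)
      (IsCMField.complexConj_ne_one (K := L)) ξ.η ξ'.η ξ.hη ξ'.hη hη)
    (torusCharacter_eq_of_split' (IsCMField.complexConj L) (Algebra.IsQuadraticExtension.finrank_eq_two _ L)
      (IsCMField.complexConj_ne_one (K := L)) ξ.ψ ξ'.ψ ξ.hψ ξ'.hψ hψ)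

/-- The label `locη w` determines the local component `η̃_w` (it is its inverse). [cite: Rogawski1990, §12.1 p. 172] -/
theorem bcη_localComponent_eq_of_locη_eq {ξ ξ' : OneDimAutRepH L} {w : HeightOneSpectrum (𝓞 L)} (h : ξ.locη w = ξ'.locη w) :
    ξ.bcη.localComponent w = ξ'.bcη.localComponent w :=
  MonoidHom.ext fun a => inv_injective (by rw [← locη_apply, ← locη_apply, h])

/-- The label `locψ w` determines the local component `ψ̃_w`. [cite: Rogawski1990, §12.1 p. 172] -/
theorem bcψ_localComponent_eq_of_locψ_eq {ξ ξ' : OneDimAutRepH L} {w : HeightOneSpectrum (𝓞 L)} (h : ξ.locψ w = ξ'.locψ w) :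
    ξ.bcψ.localComponent w = ξ'.bcψ.localComponent w :=
  MonoidHom.ext fun a => inv_injective (by rw [← locψ_apply, ← locψ_apply, h])

/-- The labels `(splitν₀ μω w, locψ w)` for ONE auxiliary `μω` determine `locη w` (`ν₀ = η_w ψ_w μ_w`: cancel `ψ_w μ_w`).
[cite: Rogawski1990, §4.13 Lemma 4.13.1 (b)] -/
theorem locη_eq_of_splitν₀_eq {ξ ξ' : OneDimAutRepH L} (μω : HeckeCharacter L) {w : HeightOneSpectrum (𝓞 L)}
    (hν : ξ.splitν₀ μω w = ξ'.splitν₀ μω w) (hψ : ξ.locψ w = ξ'.locψ w) : ξ.locη w = ξ'.locη w := by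
  refine MonoidHom.ext fun a => ?_
  have h1 := DFunLike.congr_fun hν a
  rw [splitν₀_apply, splitν₀_apply, ← hψ] at h1
  exact mul_right_cancel (mul_right_cancel h1)

/-- **`ξ = ξ′` FROM THE BASE CHANGES AT ONE PLACE ABOVE EVERY SPLIT PLACE** (the shape ★
`F0P3XiLocalLabelsOfMemXiFamily.bc_localComponent_eq_of_memXiFamily_witnesses` delivers): if for every finite place `v` of `L⁺`
that splits in `L` there is a place `w ∣ v` with `η̃_w = η̃′_w` and `ψ̃_w = ψ̃′_w`, then `ξ = ξ′` (the fibre above a split `v` is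
`{w, c̄⁻¹ • w}`, ★ `PlacesOver.eq_or_eq_galInv`; the other place is carried by the split-place convention ★
`pullback_localComponent_smul`). [cite: Rogawski1990, §13.1 p. 199; §12.2 pp. 173–174]
[cite: CasselsFrohlichANT1967, Ch. VII §4 Prop. 4.1] [cite: PlatonovRapinchuk1994, §7.3 Prop. 7.8] -/
theorem ext_of_exists_bc_localComponent_eq_of_split {ξ ξ' : OneDimAutRepH L}
    (h : ∀ v : HeightOneSpectrum (𝓞 ↥(maximalRealSubfield L)), (∃ w : PlacesOver L v, IsCMField.complexConj L • w.1 ≠ w.1) →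
      ∃ w : PlacesOver L v, ξ.bcη.localComponent w.1 = ξ'.bcη.localComponent w.1 ∧
        ξ.bcψ.localComponent w.1 = ξ'.bcψ.localComponent w.1) :
    ξ = ξ' := by
  have hc := IsCMField.complexConj_ne_one (K := L)
  have key : ∀ w : HeightOneSpectrum (𝓞 L), IsCMField.complexConj L • w ≠ w →
      (ξ.bcη.localComponent w = ξ'.bcη.localComponent w ∧ ξ.bcψ.localComponent w = ξ'.bcψ.localComponent w) ∨
        (ξ.bcη.localComponent (IsCMField.complexConj L • w) = ξ'.bcη.localComponent (IsCMField.complexConj L • w) ∧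
          ξ.bcψ.localComponent (IsCMField.complexConj L • w) = ξ'.bcψ.localComponent (IsCMField.complexConj L • w)) := by
    intro w hw
    obtain ⟨w₀, hη₀, hψ₀⟩ := h (w.under _) ⟨⟨w, rfl⟩, hw⟩
    rcases PlacesOver.eq_or_eq_galInv (IsCMField.complexConj L) hc ⟨w, rfl⟩ w₀ with h₀ | h₀
    · left
      rw [h₀] at hη₀ hψ₀
      exact ⟨hη₀, hψ₀⟩
    · right
      rw [h₀] at hη₀ hψ₀
      change ξ.bcη.localComponent (_⁻¹ • w) = ξ'.bcη.localComponent (_⁻¹ • w) at hη₀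
      change ξ.bcψ.localComponent (_⁻¹ • w) = ξ'.bcψ.localComponent (_⁻¹ • w) at hψ₀
      rw [inv_smul_place (IsCMField.complexConj L) (Algebra.IsQuadraticExtension.finrank_eq_two _ L) hc] at hη₀ hψ₀
      exact ⟨hη₀, hψ₀⟩
  refine ext_of_bc_localComponent_eq_of_split' (fun w hw => ?_) (fun w hw => ?_)
  · rcases key w hw with ⟨hη, -⟩ | ⟨hη, -⟩
    · exact Or.inl hη
    · exact Or.inr hη
  · rcases key w hw with ⟨-, hψ⟩ | ⟨-, hψ⟩
    · exact Or.inl hψ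
    · exact Or.inr hψ

/-- **`ξ = ξ′` FROM THE D6 LABELS `(locη, locψ)` AT ONE PLACE ABOVE EVERY SPLIT PLACE.** [cite: Rogawski1990, §13.1 p. 199;
§12.2 pp. 173–174] [cite: CasselsFrohlichANT1967, Ch. VII §4 Prop. 4.1] [cite: PlatonovRapinchuk1994, §7.3 Prop. 7.8] -/
theorem ext_of_locLabels_eq_of_split {ξ ξ' : OneDimAutRepH L}
    (h : ∀ v : HeightOneSpectrum (𝓞 ↥(maximalRealSubfield L)), (∃ w : PlacesOver L v, IsCMField.complexConj L • w.1 ≠ w.1) →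
      ∃ w : PlacesOver L v, ξ.locη w.1 = ξ'.locη w.1 ∧ ξ.locψ w.1 = ξ'.locψ w.1) :
    ξ = ξ' :=
  ext_of_exists_bc_localComponent_eq_of_split fun v hv => by
    obtain ⟨w, hη, hψ⟩ := h v hv
    exact ⟨w, bcη_localComponent_eq_of_locη_eq hη, bcψ_localComponent_eq_of_locψ_eq hψ⟩

/-- **`ξ = ξ′` FROM THE SPLIT MEMBERS' LABELS `(ν₀, χ′) = (splitν₀ μω, locψ)`** of ★ `cmSplitPacket` ∕ ★ `IsXiLocalFamily`, for ONE
auxiliary Hecke character `μω`: if above every split `v` there is a place `w` with `ξ.splitν₀ μω w = ξ′.splitν₀ μω w` and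
`ξ.locψ w = ξ′.locψ w`, then `ξ = ξ′`.  The global half of «a ξ-local family determines `ξ`»; that the split member
`i_G(ξ_v ⊗ μ_w ∘ det₀)` determines its labels is NOT claimed here. [cite: Rogawski1990, §13.1 p. 199; §4.13 Lemma 4.13.1 (b)]
[cite: CasselsFrohlichANT1967, Ch. VII §4 Prop. 4.1] [cite: PlatonovRapinchuk1994, §7.3 Prop. 7.8] -/
theorem ext_of_splitLabels_eq_of_split {ξ ξ' : OneDimAutRepH L} (μω : HeckeCharacter L)
    (h : ∀ v : HeightOneSpectrum (𝓞 ↥(maximalRealSubfield L)), (∃ w : PlacesOver L v, IsCMField.complexConj L • w.1 ≠ w.1) →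
      ∃ w : PlacesOver L v, ξ.splitν₀ μω w.1 = ξ'.splitν₀ μω w.1 ∧ ξ.locψ w.1 = ξ'.locψ w.1) :
    ξ = ξ' :=
  ext_of_locLabels_eq_of_split fun v hv => by
    obtain ⟨w, hν, hψ⟩ := h v hv
    exact ⟨w, locη_eq_of_splitν₀_eq μω hν hψ, hψ⟩

end OneDimAutRepH

end Literature.NumberTheory.Rogawski1990

end
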